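import Mathlib
import HarnessLib

/-!
# The Lovász–Schrijver `N₊`-rank of the matching polytope (Stephen–Tunçel 1999)

T. Stephen, L. Tunçel, *On a representation of the matching polytope via semidefinite liftings*,
Math. Oper. Res. **24** (1999) 1–7 [StephenTuncel1999] (held: `paper:doi-10-1287-moor-24-1-1`,
7 PDF pages, read in full). Abstract (p. 1): "We consider the relaxation of the matching polytope
defined by the non-negativity and degree constraints. We prove that given an undirected graph on
`n` nodes and the corresponding relaxation of the matching polytope, `⌊n/2⌋` iterations of the
Lovász–Schrijver semidefinite lifting procedure are needed to obtain the matching polytope, in the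
worst case. We show that `⌊n/2⌋` iterations of the procedure always suffice."

This is the oldest "matchings defeat semidefinite hierarchies" theorem (the `N₊` operator of
Lovász–Schrijver 1991 [LovaszSchrijver1991]); it completes the tree's catalogue next to the
sum-of-squares / Lasserre degree bounds for the perfect matching principle
(`Literature.Computability.Complexity.Mod2SosDegreeExplicit`) and the symmetric-SDP lower bound
(`Literature.Combinatorics.Optimization.MatchingSymmetricSdpExplicitBound`). The `N₊` operator
was not in the tree (`LasserreStableBound.lean`, "Not here: … the Lovász–Schrijver `N₊` operator";
searched `lean search 'LovaszSchrijver|N_plus|liftAndProject'`).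

## The printed setting (§2–§3, pp. 2–3), followed verbatim (CONE form)

* §2 (p. 2): `P(G) := {x ∈ ℝ^E : x(δ(v)) ≤ 1 ∀ v ∈ V, x ≥ 0}`, `P_I(G) := conv(P(G) ∩ ℤ^E)` the
  matching polytope; "Instead of `P(G)` and `P_I(G)`, we will deal with the related cones
  `P := {x ∈ ℝ^{E ∪ {0}} : x(δ(v)) ≤ x₀ ∀ v ∈ V, x ≥ 0}`, `P_I := …`"; "`P(2k+1)`, `P_I(2k+1)`
  refer to the cones `P` and `P_I` defined by the clique on `2k+1` nodes."
* §3 (p. 2): "`K_I` denotes the cone generated by all 0-1 vectors of `K`." **Definition 3.1.** "A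
  `(d+1) × (d+1)` matrix `Y` with real entries is in `M(K, Q)` if (i) `Y = Yᵀ`, (ii)
  `Y e₀ = Diag(Y)`, (iii) `uᵀ Y v ≥ 0 ∀ u ∈ K*, v ∈ Q*`." **Definition 3.2.** "`Y ∈ M₊(K, Q)` if
  `Y ∈ M(K, Q)` and `Y` is positive semidefinite." "`N(K) := {Diag(Y) : Y ∈ M(K,Q)}`,
  `N₊(K) := {Diag(Y) : Y ∈ M₊(K,Q)}`", "`N⁰₊(K) := K`, `Nʳ₊(K) := N₊(N^{r-1}₊(K))`." And (p. 3):
  "Lovász–Schrijver also note that the condition (iii) of Definition 3.1 is equivalent to (iii*)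
  `Y eᵢ ∈ K` for all `i ∈ {0, 1, …, d}` and `Y(e₀ − eᵢ) ∈ K` for all `i ∈ {1, …, d}`."
  We take (iii*) as the definition (`LovaszSchrijver.IsLiftMatrix`); for the closed polyhedral
  cones of the paper the two agree, as printed.
* **Theorem 3.1** (Lovász–Schrijver 1991; p. 3): `K ⊇ N₊(K) ⊇ N²₊(K) ⊇ ⋯ ⊇ Nᵈ₊(K) = K_I`.
  PROVED here: the chain and `K_I ⊆ Nʳ₊(K)` for every `r` and every pointed cone `K ⊆ Q`
  (`iterate_Nplus_antitone`, `integralCone_subset_iterate_Nplus`); the finite convergence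
  `Nᵈ(K) = Nᵈ₊(K) = K_I` (`d = |ι|`, `ι` nonempty) is PROVED in the sibling file
  `LovaszSchrijverFiniteConvergence.lean` (`iterate_N_card_eq_integralCone`,
  `iterate_Nplus_card_eq_integralCone`), so Theorem 3.1 as printed is a tree theorem.

## The printed results (§4–§5, pp. 3–7)

* **Lemma 4.2** (p. 5): "`(1, (1/2n) e) ∈ N^{n-1}₊(P(2n+1))`, for all `n ≥ 1`." (Proof pp. 3–6:
  the maps `wⁱ` of Lemma 4.1 and an explicit matrix `Y` whose scaling `Ŷ = 2k(2k+2)Y` has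
  eigenvalues `6k²+7k`, `2k+1`, `0` with multiplicities `1`, `k(2k+3)`, `2k+3`.) — named fact
  `StephenTuncel1999_lemma42`, DISCHARGED in the sibling file
  `LovaszSchrijverMatchingRankProof.lean` (`StephenTuncel1999_lemma42_holds`, which follows the
  printed proof; hence `Nʳ₊(P(2n+1)) ≠ P_I(2n+1)` for `r < n` is unconditional there,
  `iterate_Nplus_ne_matchingCone`).
* **Theorem 5.1** (p. 6): "`N^{n-1}₊(P(2n+1)) ≠ P_I(2n+1) = Nⁿ₊(P(2n+1))`." — PROVED here
  (`StephenTuncel1999_thm51`) from Lemma 4.2, the upper bound below, and the PROVED separation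
  "since `Σ_{j ∈ E_{2n+1}} xⱼ = (2n+1)/2 > n`, the maximum cardinality of any matching in the
  `(2n+1)` clique, `x ∉ P_I(2n+1)`" (p. 6; `zeta_not_mem_matchingCone`, via the valid inequality
  `Σ_e x_e ≤ ⌊|V|/2⌋ · x₀` on `P_I(G)`, `sum_le_of_mem_matchingCone`).
* **p. 7** (after the proof; = the abstract's "`⌊n/2⌋` iterations of the procedure always
  suffice"): "Note that the second part of the above proof applies to any undirected graph `G`,
  yielding `N^{⌊|V|/2⌋}₊(P(G)) = P_I(G)`." (Proof: Lemma 1.5 of Lovász–Schrijver 1991 in an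
  induction on the blossom inequalities `x(E(S)) ≤ l·x₀`, `|S| = 2l+1`, plus Edmonds 1965.)
  — named fact `StephenTuncel1999_rank_le_half` (Edmonds' matching polytope theorem is not in the
  tree). Consistent with Lovász–Schrijver's `N₊`-rank bound `t ≤ α` for `FR` of the line graph
  [cite: Laurent2003, §6.1 (31), p. 16].
* Consequence PROVED: the `N₊`-rank of `P(2n+1)` relative to `P_I(2n+1)` is EXACTLY `n`
  (`StephenTuncel1999_rank`: `IsLeast {r | Nʳ₊(P(2n+1)) = P_I(2n+1)} n`), and
  `Nʳ₊(P(2n+1)) ≠ P_I(2n+1)` for every `r < n` (`iterate_Nplus_ne_of_lt`, from Lemma 4.2 alone).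

Secondary source for the operators (held, read: `paper:doi-10-1287-moor-28-3-470-16391`, PDF
pp. 3–4): M. Laurent, *A comparison of the Sherali–Adams, Lovász–Schrijver, and Lasserre
relaxations for 0–1 programming*, Math. Oper. Res. 28 (2003) 470–496, §2 (conditions (2)–(3),
`P ⊆ N₊(K) ⊆ N(K) ⊆ K` with the same one-line proofs as here) [Laurent2003]; p. 18: "Stephen and
Tunçel (1999) show that `α(G) = (n−1)/2` iterations of the `N₊` operator are needed for finding
`ST(G)`" (`G` the line graph of `Kₙ`, `n` odd).

Design notes. Homogeneous coordinates are `Option ι` (`none` = the coordinate `0`); vectors are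
rows `Y i` of the symmetric matrix `Y` (so `Y e₀ = Y none`); `K_I` is Mathlib's
`PointedCone.hull` of the 0-1 vectors of `K`; graphs are Mathlib `SimpleGraph`s with edge
coordinates `G.edgeSet`, the clique being `⊤ : SimpleGraph (Fin (2n+1))` (as in the tree's
`Literature.Barriers.PneNP.pmPolytope`). No instances, no notation. Two named facts (Lemma 4.2;
the p. 7 upper bound), everything else proved; Lemma 4.2 is discharged in
`LovaszSchrijverMatchingRankProof.lean`, so only the upper bound `StephenTuncel1999_rank_le_half`
(Edmonds' matching polytope theorem + Lovász–Schrijver's Lemma 1.5) remains a named fact.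
-/

noncomputable section

open Matrix Finset

namespace Literature.Combinatorics.Optimization

/-! ## §3. The Lovász–Schrijver lifting operators `N`, `N₊` (cone form) -/

namespace LovaszSchrijver

variable {ι : Type*}

/-- The cone `Q = {x : 0 ≤ xᵢ ≤ x₀}` ("the cone generated by all 0-1 vectors `x ∈ ℝ^{d+1}` with
`x₀ = 1` is called `Q`"). [cite: StephenTuncel1999, §3 (p. 2)] -/
def coneQ (ι : Type*) : Set (Option ι → ℝ) :=
  {x | ∀ i : ι, 0 ≤ x (some i) ∧ x (some i) ≤ x none}

/-- A 0-1 vector. [cite: StephenTuncel1999, §3 (p. 2)] -/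
def IsZeroOne (v : Option ι → ℝ) : Prop := ∀ i, v i = 0 ∨ v i = 1

/-- **`Y ∈ M(K, Q)`** (Definition 3.1 in the equivalent form (iii*), p. 3): `Y` symmetric,
`Y e₀ = Diag(Y)`, every column `Y eᵢ ∈ K` and every `Y(e₀ − eᵢ) ∈ K`. Rows and columns agree by
symmetry; the homogenizing coordinate is `none`. [cite: StephenTuncel1999, Def. 3.1 and (iii*) (pp. 2–3)] -/
structure IsLiftMatrix (K : Set (Option ι → ℝ)) (Y : Matrix (Option ι) (Option ι) ℝ) : Prop where
  symm : Y.IsSymm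
  diag_eq : ∀ i : ι, Y (some i) (some i) = Y none (some i)
  row_mem : ∀ i : Option ι, Y i ∈ K
  sub_mem : ∀ i : ι, Y none - Y (some i) ∈ K

/-- **`N(K) := {Diag(Y) : Y ∈ M(K, Q)}`** (`= {Y e₀ : Y ∈ M(K,Q)}`). [cite: StephenTuncel1999, §3 (p. 2)] -/
def N (K : Set (Option ι → ℝ)) : Set (Option ι → ℝ) :=
  {x | ∃ Y, IsLiftMatrix K Y ∧ Y none = x}

/-- **`N₊(K) := {Diag(Y) : Y ∈ M₊(K, Q)}`**, `M₊ = M ∩ PSD` (Definition 3.2).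
[cite: StephenTuncel1999, Def. 3.2 and §3 (p. 2)] -/
def Nplus (K : Set (Option ι → ℝ)) : Set (Option ι → ℝ) :=
  {x | ∃ Y, IsLiftMatrix K Y ∧ Y.PosSemidef ∧ Y none = x}

/-- **`K_I`**: "the cone generated by all 0-1 vectors of `K`". [cite: StephenTuncel1999, §3 (p. 2)] -/
def integralCone (K : Set (Option ι → ℝ)) : Set (Option ι → ℝ) :=
  (PointedCone.hull ℝ {v | v ∈ K ∧ IsZeroOne v} : Set (Option ι → ℝ))

/-- `N₊(K) ⊆ N(K)`. [cite: StephenTuncel1999, §3 (p. 2)] -/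
theorem Nplus_subset_N (K : Set (Option ι → ℝ)) : Nplus K ⊆ N K :=
  fun _ ⟨Y, hY, _, hx⟩ => ⟨Y, hY, hx⟩

/-- `N(K) ⊆ K` (take `i = 0` in (iii*)). [cite: StephenTuncel1999, Thm. 3.1 (p. 3)] -/
theorem N_subset (K : Set (Option ι → ℝ)) : N K ⊆ K := by
  rintro x ⟨Y, hY, rfl⟩
  exact hY.row_mem none

/-- `N₊(K) ⊆ K`. [cite: StephenTuncel1999, Thm. 3.1 (p. 3)] -/
theorem Nplus_subset (K : Set (Option ι → ℝ)) : Nplus K ⊆ K :=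
  (Nplus_subset_N K).trans (N_subset K)

/-- `M(K,Q)` is monotone in `K` (immediate from Definition 3.1 (iii*)). [cite: StephenTuncel1999, Def. 3.1 and (iii*) (pp. 2–3)] -/
theorem IsLiftMatrix.mono {K K' : Set (Option ι → ℝ)} (h : K ⊆ K')
    {Y : Matrix (Option ι) (Option ι) ℝ} (hY : IsLiftMatrix K Y) : IsLiftMatrix K' Y :=
  ⟨hY.symm, hY.diag_eq, fun i => h (hY.row_mem i), fun i => h (hY.sub_mem i)⟩

/-- `N` is monotone in `K` (immediate from the definition). [cite: StephenTuncel1999, §3, Def. 3.1 (pp. 2–3)] -/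
theorem N_mono {K K' : Set (Option ι → ℝ)} (h : K ⊆ K') : N K ⊆ N K' :=
  fun _ ⟨Y, hY, hx⟩ => ⟨Y, hY.mono h, hx⟩

/-- `N₊` is monotone in `K` (immediate from the definition). [cite: StephenTuncel1999, §3, Def. 3.2 (p. 2)] -/
theorem Nplus_mono {K K' : Set (Option ι → ℝ)} (h : K ⊆ K') : Nplus K ⊆ Nplus K' :=
  fun _ ⟨Y, hY, hP, hx⟩ => ⟨Y, hY.mono h, hP, hx⟩

/-- `N^{r+1}₊(K) ⊆ Nʳ₊(K)`. [cite: StephenTuncel1999, Thm. 3.1 (p. 3)] -/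
theorem iterate_Nplus_succ_subset (K : Set (Option ι → ℝ)) (r : ℕ) :
    Nplus^[r + 1] K ⊆ Nplus^[r] K := by
  rw [Function.iterate_succ_apply']
  exact Nplus_subset _

/-- The chain `K ⊇ N₊(K) ⊇ N²₊(K) ⊇ ⋯`. [cite: StephenTuncel1999, Thm. 3.1 (p. 3)] -/
theorem iterate_Nplus_antitone (K : Set (Option ι → ℝ)) {r s : ℕ} (h : r ≤ s) :
    Nplus^[s] K ⊆ Nplus^[r] K := by
  induction h with
  | refl => exact le_rfl
  | step _ ih => exact (iterate_Nplus_succ_subset K _).trans ih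

/-- `Nʳ₊(K) ⊆ K`. [cite: StephenTuncel1999, Thm. 3.1 (p. 3)] -/
theorem iterate_Nplus_subset (K : Set (Option ι → ℝ)) (r : ℕ) : Nplus^[r] K ⊆ K :=
  iterate_Nplus_antitone K (Nat.zero_le r)

/-- `Nʳ₊` is monotone in `K` (immediate from the definition `Nʳ₊(K) := N₊(N^{r-1}₊(K))`). [cite: StephenTuncel1999, §3 (p. 2)] -/
theorem iterate_Nplus_mono {K K' : Set (Option ι → ℝ)} (h : K ⊆ K') (r : ℕ) :
    Nplus^[r] K ⊆ Nplus^[r] K' := by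
  induction r with
  | zero => exact h
  | succ r ih =>
    rw [Function.iterate_succ_apply', Function.iterate_succ_apply']
    exact Nplus_mono ih

/-! ### `M₊(K, Q)` and `N₊(K)` are cones when `K` is -/

/-- `M₊` of a cone is closed under sums (used on p. 5: "a nonnegative linear combination of
elements of `N^{k-1}₊(P(2k+3))`" lies in it). [cite: StephenTuncel1999, proof of Lemma 4.2 (p. 5)] -/
theorem IsLiftMatrix.add {C : PointedCone ℝ (Option ι → ℝ)} {Y Z : Matrix (Option ι) (Option ι) ℝ}
    (hY : IsLiftMatrix (C : Set (Option ι → ℝ)) Y) (hZ : IsLiftMatrix (C : Set (Option ι → ℝ)) Z) :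
    IsLiftMatrix (C : Set (Option ι → ℝ)) (Y + Z) where
  symm := hY.symm.add hZ.symm
  diag_eq i := by simp [hY.diag_eq i, hZ.diag_eq i]
  row_mem i := by
    change Y i + Z i ∈ (C : Set (Option ι → ℝ))
    exact C.add_mem (hY.row_mem i) (hZ.row_mem i)
  sub_mem i := by
    have h := C.add_mem (hY.sub_mem i) (hZ.sub_mem i)
    have e : (Y + Z) none - (Y + Z) (some i) = (Y none - Y (some i)) + (Z none - Z (some i)) := by
      ext j
      simp only [Pi.sub_apply, Pi.add_apply, Matrix.add_apply]
      ring
    rw [e]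
    exact h

/-- `M₊` of a cone is closed under nonnegative multiples (p. 5: "`Yeᵢ` is a positive multiple of
`wⁱ(ζ)`", "nonnegative linear combination"). [cite: StephenTuncel1999, proof of Lemma 4.2 (p. 5)] -/
theorem IsLiftMatrix.smul {C : PointedCone ℝ (Option ι → ℝ)} {Y : Matrix (Option ι) (Option ι) ℝ}
    (hY : IsLiftMatrix (C : Set (Option ι → ℝ)) Y) {c : ℝ} (hc : 0 ≤ c) :
    IsLiftMatrix (C : Set (Option ι → ℝ)) (c • Y) where
  symm := hY.symm.smul c
  diag_eq i := by simp [hY.diag_eq i]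
  row_mem i := by
    change c • Y i ∈ (C : Set (Option ι → ℝ))
    exact C.smul_mem hc (hY.row_mem i)
  sub_mem i := by
    have h := C.smul_mem hc (hY.sub_mem i)
    rw [show (c • Y) none - (c • Y) (some i) = c • (Y none - Y (some i)) from
      (smul_sub c (Y none) (Y (some i))).symm]
    exact h

/-- The zero matrix is a lift matrix of any cone ("Clearly, `0 ∈ Nʳ₊(P(2k+3))`", p. 4).
[cite: StephenTuncel1999, proof of Lemma 4.1 (p. 4)] -/
theorem IsLiftMatrix.zero (C : PointedCone ℝ (Option ι → ℝ)) :
    IsLiftMatrix (C : Set (Option ι → ℝ)) 0 where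
  symm := Matrix.isSymm_zero
  diag_eq i := by simp
  row_mem i := by
    change (0 : Option ι → ℝ) ∈ (C : Set (Option ι → ℝ))
    exact C.zero_mem
  sub_mem i := by
    change (0 : Option ι → ℝ) - 0 ∈ (C : Set (Option ι → ℝ))
    rw [sub_zero]
    exact C.zero_mem

/-- **`N₊` of a (pointed, convex) cone is a pointed convex cone** — the bundled operator used to
iterate (the source uses exactly this: nonnegative linear combinations of elements of
`N^{k-1}₊(P(2k+3))` stay in it, p. 5). [cite: StephenTuncel1999, proof of Lemma 4.2 (p. 5)] -/
def NplusCone (C : PointedCone ℝ (Option ι → ℝ)) : PointedCone ℝ (Option ι → ℝ) where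
  carrier := Nplus (C : Set (Option ι → ℝ))
  zero_mem' := ⟨0, IsLiftMatrix.zero C, Matrix.PosSemidef.zero, rfl⟩
  add_mem' := by
    rintro x y ⟨Y, hY, hYp, rfl⟩ ⟨Z, hZ, hZp, rfl⟩
    exact ⟨Y + Z, hY.add hZ, hYp.add hZp, rfl⟩
  smul_mem' := by
    rintro ⟨c, hc⟩ x ⟨Y, hY, hYp, rfl⟩
    exact ⟨c • Y, hY.smul hc, hYp.smul hc, rfl⟩

/-- Carrier of `NplusCone` is `N₊(K)`. [cite: StephenTuncel1999, Def. 3.2 (p. 2)] -/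
@[simp] theorem coe_NplusCone (C : PointedCone ℝ (Option ι → ℝ)) :
    (NplusCone C : Set (Option ι → ℝ)) = Nplus (C : Set (Option ι → ℝ)) := rfl

/-- Carrier of the iterated bundled operator is `Nʳ₊(K) := N₊(N^{r-1}₊(K))`. [cite: StephenTuncel1999, §3 (p. 2)] -/
theorem coe_iterate_NplusCone (C : PointedCone ℝ (Option ι → ℝ)) (r : ℕ) :
    ((NplusCone^[r] C : PointedCone ℝ (Option ι → ℝ)) : Set (Option ι → ℝ)) =
      Nplus^[r] (C : Set (Option ι → ℝ)) := by
  induction r with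
  | zero => rfl
  | succ r ih => rw [Function.iterate_succ_apply', Function.iterate_succ_apply', coe_NplusCone, ih]

/-- **`K_I ⊆ N₊(K)`**, generator by generator: a 0-1 vector `v` of a cone `K ⊆ Q` (with `0 ∈ K`)
lies in `N₊(K)`, witnessed by `Y = v vᵀ`. [cite: StephenTuncel1999, Thm. 3.1 (p. 3)] [cite: Laurent2003, §2 (PDF p. 4)] -/
theorem zeroOne_mem_Nplus [Fintype ι] {K : Set (Option ι → ℝ)} (hKQ : K ⊆ coneQ ι) (hK0 : (0 : Option ι → ℝ) ∈ K)
    {v : Option ι → ℝ} (hv : v ∈ K) (h01 : IsZeroOne v) : v ∈ Nplus K := by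
  have hQ := hKQ hv
  -- if `v₀ = 0` then `v = 0`; if `v₀ = 1` the entries are `0/1`
  have hcoord : ∀ i : ι, v none * v (some i) = v (some i) := by
    intro i
    rcases h01 none with h0 | h1
    · have := (hQ i).2
      have h0i : v (some i) = 0 := le_antisymm (by simpa [h0] using this) (hQ i).1
      simp [h0, h0i]
    · simp [h1]
  have hsq : ∀ i, v i * v i = v i := by
    intro i; rcases h01 i with h | h <;> simp [h]
  refine ⟨vecMulVec v v, ⟨?_, ?_, ?_, ?_⟩, ?_, ?_⟩
  · exact Matrix.IsSymm.ext fun i j => by simp [vecMulVec_apply, mul_comm]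
  · intro i; simp [vecMulVec_apply, hsq, hcoord]
  · intro i
    have hrow : (vecMulVec v v) i = v i • v := by ext j; simp [vecMulVec_apply]
    rw [hrow]
    rcases h01 i with h | h
    · simpa [h] using hK0
    · simpa [h] using hv
  · intro i
    have hrow : (vecMulVec v v) none - (vecMulVec v v) (some i) = (v none - v (some i)) • v := by
      ext j; simp [vecMulVec_apply, sub_mul]
    rw [hrow]
    rcases h01 none with h0 | h1
    · have := (hQ i).2
      have h0i : v (some i) = 0 := le_antisymm (by simpa [h0] using this) (hQ i).1
      simpa [h0, h0i] using hK0
    · rcases h01 (some i) with h | h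
      · simpa [h1, h] using hv
      · simpa [h1, h] using hK0
  · simpa using Matrix.posSemidef_vecMulVec_self_star v
  · ext j
    rcases h01 none with h0 | h1
    · -- then `v = 0`
      have hj : v j = 0 := by
        cases j with
        | none => exact h0
        | some i => exact le_antisymm (by simpa [h0] using (hQ i).2) (hQ i).1
      simp [vecMulVec_apply, h0, hj]
    · simp [vecMulVec_apply, h1]

/-- **`K_I ⊆ N₊(K)`** for a pointed cone `K ⊆ Q`. [cite: StephenTuncel1999, Thm. 3.1 (p. 3)] [cite: Laurent2003, §2 (PDF p. 4)] -/
theorem integralCone_subset_Nplus [Fintype ι] (C : PointedCone ℝ (Option ι → ℝ))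
    (hCQ : (C : Set (Option ι → ℝ)) ⊆ coneQ ι) :
    integralCone (C : Set (Option ι → ℝ)) ⊆ Nplus (C : Set (Option ι → ℝ)) := by
  intro x hx
  have h : PointedCone.hull ℝ {v | v ∈ (C : Set (Option ι → ℝ)) ∧ IsZeroOne v} ≤ NplusCone C :=
    Submodule.span_le.mpr fun v hv => zeroOne_mem_Nplus hCQ C.zero_mem hv.1 hv.2
  exact h hx

/-- `K_I ⊆ K` for a pointed cone `K`. [cite: StephenTuncel1999, Thm. 3.1 (p. 3)] -/
theorem integralCone_subset_self (C : PointedCone ℝ (Option ι → ℝ)) :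
    integralCone (C : Set (Option ι → ℝ)) ⊆ (C : Set (Option ι → ℝ)) := by
  intro x hx
  have h : PointedCone.hull ℝ {v | v ∈ (C : Set (Option ι → ℝ)) ∧ IsZeroOne v} ≤ C :=
    Submodule.span_le.mpr fun v hv => hv.1
  exact h hx

/-- `K_I` ("the cone generated by all 0-1 vectors of `K`") is monotone in `K` (immediate).
[cite: StephenTuncel1999, §3 (p. 2)] -/
theorem integralCone_mono {K K' : Set (Option ι → ℝ)} (h : K ⊆ K') :
    integralCone K ⊆ integralCone K' := by
  intro x hx
  have hle : PointedCone.hull ℝ {v | v ∈ K ∧ IsZeroOne v} ≤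
      PointedCone.hull ℝ {v | v ∈ K' ∧ IsZeroOne v} :=
    Submodule.span_mono fun v hv => ⟨h hv.1, hv.2⟩
  exact hle hx

/-- **Theorem 3.1 (Lovász–Schrijver), the part `K_I ⊆ Nʳ₊(K)` for every `r`**, for a pointed
cone `K ⊆ Q`. [cite: StephenTuncel1999, Thm. 3.1 (p. 3)] -/
theorem integralCone_subset_iterate_Nplus [Fintype ι] (C : PointedCone ℝ (Option ι → ℝ))
    (hCQ : (C : Set (Option ι → ℝ)) ⊆ coneQ ι) (r : ℕ) :
    integralCone (C : Set (Option ι → ℝ)) ⊆ Nplus^[r] (C : Set (Option ι → ℝ)) := by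
  induction r with
  | zero => exact integralCone_subset_self C
  | succ r ih =>
    -- `C' := Nʳ₊(C)` is a pointed cone inside `C ⊆ Q` containing the 0-1 vectors of `C`
    have hC' : ((NplusCone^[r] C : PointedCone ℝ (Option ι → ℝ)) : Set (Option ι → ℝ)) =
        Nplus^[r] (C : Set (Option ι → ℝ)) := coe_iterate_NplusCone C r
    have hsub : ((NplusCone^[r] C : PointedCone ℝ (Option ι → ℝ)) : Set (Option ι → ℝ)) ⊆ coneQ ι :=
      (hC'.symm ▸ iterate_Nplus_subset _ r).trans hCQ
    have h1 := integralCone_subset_Nplus (NplusCone^[r] C) hsub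
    rw [hC'] at h1
    rw [Function.iterate_succ_apply']
    refine Set.Subset.trans ?_ h1
    -- generators of `C_I` lie in `Nʳ₊(C)` by the induction hypothesis
    intro x hx
    have hle : PointedCone.hull ℝ {v | v ∈ (C : Set (Option ι → ℝ)) ∧ IsZeroOne v} ≤
        PointedCone.hull ℝ {v | v ∈ Nplus^[r] (C : Set (Option ι → ℝ)) ∧ IsZeroOne v} :=
      Submodule.span_mono fun v hv => ⟨ih (Submodule.subset_span hv), hv.2⟩
    exact hle hx

end LovaszSchrijver

/-! ## §2. The matching cones `P(G) ⊇ P_I(G)` -/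

namespace StephenTuncel1999

open LovaszSchrijver

variable {V : Type*} [Fintype V] [DecidableEq V] (G : SimpleGraph V) [DecidableRel G.Adj]

/-- **`P(G)` in cone form**: `P := {x ∈ ℝ^{E ∪ {0}} : x(δ(v)) ≤ x₀ ∀ v ∈ V, x ≥ 0}` (coordinate
`0` is `none`, the edge `e` is `some e`). [cite: StephenTuncel1999, §2 (p. 2)] -/
def fracMatchingCone : Set (Option G.edgeSet → ℝ) :=
  {x | (∀ i, 0 ≤ x i) ∧
    ∀ v : V, (∑ e ∈ univ.filter (fun e : G.edgeSet => v ∈ (e : Sym2 V)), x (some e)) ≤ x none}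

/-- **`P_I(G)`**, the cone generated by the 0-1 vectors of `P(G)` (the homogenized matching
polytope: its 0-1 vectors are `0` and the `(1, χ^M)`, `M` a matching).
[cite: StephenTuncel1999, §2–§3 (p. 2)] -/
def matchingCone : Set (Option G.edgeSet → ℝ) :=
  integralCone (fracMatchingCone G)

/-- `P(G)` bundled as a pointed cone ("the related cones `P`", p. 2). [cite: StephenTuncel1999, §2 (p. 2)] -/
def fracMatchingPointedCone : PointedCone ℝ (Option G.edgeSet → ℝ) where
  carrier := fracMatchingCone G
  zero_mem' := ⟨fun _ => le_rfl, fun v => by simp⟩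
  add_mem' := by
    rintro x y ⟨hx0, hx⟩ ⟨hy0, hy⟩
    refine ⟨fun i => add_nonneg (hx0 i) (hy0 i), fun v => ?_⟩
    simpa [sum_add_distrib] using add_le_add (hx v) (hy v)
  smul_mem' := by
    rintro ⟨c, hc⟩ x ⟨hx0, hx⟩
    refine ⟨fun i => mul_nonneg hc (hx0 i), fun v => ?_⟩
    have h := mul_le_mul_of_nonneg_left (hx v) hc
    simpa [mul_sum] using h

omit [Fintype V] [DecidableEq V] [DecidableRel G.Adj] in
/-- Every edge has an endpoint. [folklore] -/
private theorem exists_mem_edge (e : G.edgeSet) : ∃ v : V, v ∈ (e : Sym2 V) :=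
  ⟨(e : Sym2 V).out.1, Sym2.out_fst_mem _⟩

/-- `P(G) ⊆ Q`: `0 ≤ x_e ≤ x(δ(v)) ≤ x₀` for an endpoint `v` of `e`. [cite: StephenTuncel1999, §2–§3 (p. 2)] -/
theorem fracMatchingCone_subset_coneQ : fracMatchingCone G ⊆ coneQ G.edgeSet := by
  rintro x ⟨hx0, hx⟩ e
  obtain ⟨v, hv⟩ := exists_mem_edge G e
  refine ⟨hx0 (some e), le_trans ?_ (hx v)⟩
  exact single_le_sum (f := fun e : G.edgeSet => x (some e)) (fun i _ => hx0 (some i))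
    (mem_filter.mpr ⟨mem_univ _, hv⟩)

/-- **`P_I(G) ⊆ Nʳ₊(P(G))` for every `r`** (Theorem 3.1 for the matching cones).
[cite: StephenTuncel1999, Thm. 3.1 (p. 3) and proof of Thm. 5.1 (p. 6)] -/
theorem matchingCone_subset_iterate_Nplus (r : ℕ) :
    matchingCone G ⊆ Nplus^[r] (fracMatchingCone G) :=
  integralCone_subset_iterate_Nplus (fracMatchingPointedCone G) (fracMatchingCone_subset_coneQ G) r

omit [DecidableRel G.Adj] in
/-- An edge has exactly two endpoints. [folklore] -/
private theorem card_filter_mem_edge (e : G.edgeSet) :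
    (univ.filter (fun v : V => v ∈ (e : Sym2 V))).card = 2 := by
  classical
  obtain ⟨e, he⟩ := e
  induction e using Sym2.ind with
  | h a b =>
    have hab : a ≠ b := G.ne_of_adj (by simpa using he)
    have : univ.filter (fun v : V => v ∈ s(a, b)) = {a, b} := by
      ext v
      simp
    rw [this, card_pair hab]

/-- Double counting: `2 Σ_e x_e = Σ_v x(δ(v))`. [folklore] -/
private theorem two_mul_sum_edges (x : Option G.edgeSet → ℝ) :
    2 * ∑ e : G.edgeSet, x (some e) =
      ∑ v : V, ∑ e ∈ univ.filter (fun e : G.edgeSet => v ∈ (e : Sym2 V)), x (some e) := by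
  classical
  calc 2 * ∑ e : G.edgeSet, x (some e)
      = ∑ e : G.edgeSet, ∑ v ∈ univ.filter (fun v : V => v ∈ (e : Sym2 V)), x (some e) := by
        rw [mul_sum]
        refine sum_congr rfl fun e _ => ?_
        rw [sum_const, card_filter_mem_edge G e, nsmul_eq_mul]
        push_cast
        ring
    _ = ∑ e : G.edgeSet, ∑ v : V, if v ∈ (e : Sym2 V) then x (some e) else 0 := by
        refine sum_congr rfl fun e _ => ?_
        rw [sum_filter]
    _ = ∑ v : V, ∑ e : G.edgeSet, if v ∈ (e : Sym2 V) then x (some e) else 0 := sum_comm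
    _ = ∑ v : V, ∑ e ∈ univ.filter (fun e : G.edgeSet => v ∈ (e : Sym2 V)), x (some e) := by
        refine sum_congr rfl fun v _ => ?_
        rw [sum_filter]

/-- On `P(G)`: `2 Σ_e x_e ≤ |V| · x₀`. [cite: StephenTuncel1999, proof of Thm. 5.1 (p. 6)] -/
theorem two_mul_sum_le_of_mem_fracMatchingCone {x : Option G.edgeSet → ℝ}
    (hx : x ∈ fracMatchingCone G) :
    2 * ∑ e : G.edgeSet, x (some e) ≤ Fintype.card V * x none := by
  rw [two_mul_sum_edges G x]
  calc ∑ v : V, ∑ e ∈ univ.filter (fun e : G.edgeSet => v ∈ (e : Sym2 V)), x (some e)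
      ≤ ∑ _v : V, x none := sum_le_sum fun v _ => hx.2 v
    _ = Fintype.card V * x none := by simp

/-- A 0-1 vector of `P(G)` is `0` or the incidence vector of a matching; in either case
`Σ_e x_e ≤ ⌊|V|/2⌋ · x₀` ("the maximum cardinality of any matching").
[cite: StephenTuncel1999, proof of Thm. 5.1 (p. 6)] -/
theorem sum_le_of_zeroOne {x : Option G.edgeSet → ℝ} (hx : x ∈ fracMatchingCone G)
    (h01 : IsZeroOne x) :
    ∑ e : G.edgeSet, x (some e) ≤ ((Fintype.card V / 2 : ℕ) : ℝ) * x none := by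
  classical
  -- the sum is a natural number `m` with `2m ≤ |V| x₀`
  obtain ⟨m, hm⟩ : ∃ m : ℕ, ∑ e : G.edgeSet, x (some e) = m := by
    refine ⟨(univ.filter fun e : G.edgeSet => x (some e) = 1).card, ?_⟩
    rw [← sum_boole, eq_comm]
    · refine sum_congr rfl fun e _ => ?_
      rcases h01 (some e) with h | h <;> simp [h]
  have h2 := two_mul_sum_le_of_mem_fracMatchingCone G hx
  rw [hm] at h2 ⊢
  rcases h01 none with h0 | h1
  · -- `x₀ = 0` forces `m = 0`
    have : (m : ℝ) ≤ 0 := by nlinarith [h2, h0]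
    have hm0 : m = 0 := by exact_mod_cast le_antisymm this (Nat.cast_nonneg m)
    simp [hm0, h0]
  · rw [h1, mul_one] at h2 ⊢
    have h2' : 2 * m ≤ Fintype.card V := by exact_mod_cast h2
    exact_mod_cast (show m ≤ Fintype.card V / 2 by omega)

/-- **The valid inequality `Σ_e x_e ≤ ⌊|V|/2⌋ · x₀` on `P_I(G)`.**
[cite: StephenTuncel1999, proof of Thm. 5.1 (p. 6)] -/
theorem sum_le_of_mem_matchingCone {x : Option G.edgeSet → ℝ} (hx : x ∈ matchingCone G) :
    ∑ e : G.edgeSet, x (some e) ≤ ((Fintype.card V / 2 : ℕ) : ℝ) * x none := by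
  classical
  unfold matchingCone integralCone at hx
  refine Submodule.span_induction (p := fun y _ => ∑ e : G.edgeSet, y (some e) ≤
      ((Fintype.card V / 2 : ℕ) : ℝ) * y none) ?_ ?_ ?_ ?_ hx
  · exact fun v hv => sum_le_of_zeroOne G hv.1 hv.2
  · simp
  · intro x y _ _ hx hy
    simpa [sum_add_distrib, mul_add] using add_le_add hx hy
  · rintro ⟨c, hc⟩ x _ hx
    have h := mul_le_mul_of_nonneg_left hx hc
    have e1 : ∑ e : G.edgeSet, ((⟨c, hc⟩ : {c : ℝ // 0 ≤ c}) • x) (some e) =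
        c * ∑ e : G.edgeSet, x (some e) := by
      rw [mul_sum]; rfl
    have e2 : ((⟨c, hc⟩ : {c : ℝ // 0 ≤ c}) • x) none = c * x none := rfl
    rw [e1, e2]
    linarith

/-! ## §4–§5. The clique `K_{2n+1}`: Lemma 4.2, Theorem 5.1, the `N₊`-rank `n` -/

/-- The fractional point `ζ = (1, (1/2n) e)` of `P(2n+1)` (all edge coordinates `1/(2n)`).
[cite: StephenTuncel1999, §4 (p. 4) and Lemma 4.2 (p. 5)] -/
def zeta (n : ℕ) : Option ((⊤ : SimpleGraph (Fin (2 * n + 1))).edgeSet) → ℝ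
  | none => 1
  | some _ => (2 * n : ℝ)⁻¹

/-- **Lemma 4.2** (named fact, as printed): "`(1, (1/2n) e) ∈ N^{n-1}₊(P(2n+1))`, for all
`n ≥ 1`." Proof in the source: Lemma 4.1 (the restriction maps `wⁱ : P(2k+1) → P(2k+3)` commute
with `Nʳ₊`) and an explicit `Y ∈ M₊(N^{k-1}₊(P(2k+3)))` whose scaling `Ŷ = 2k(2k+2)Y` has
spectrum `{6k²+7k, 2k+1, 0}` with multiplicities `1, k(2k+3), 2k+3` (pp. 3–6). PROVED in
`LovaszSchrijverMatchingRankProof.lean`: `StephenTuncel1999_lemma42_holds : StephenTuncel1999_lemma42`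
(this `def` stays the named statement; feed users `(h : StephenTuncel1999_lemma42)` with it).
[cite: StephenTuncel1999, Lemma 4.2 (p. 5)] -/
def StephenTuncel1999_lemma42 : Prop :=
  ∀ n : ℕ, 1 ≤ n →
    zeta n ∈ Nplus^[n - 1] (fracMatchingCone (⊤ : SimpleGraph (Fin (2 * n + 1))))

/-- **The upper bound for every graph** (named fact, as printed, p. 7 and abstract): "the second
part of the above proof applies to any undirected graph `G`, yielding
`N^{⌊|V|/2⌋}₊(P(G)) = P_I(G)`" — "`⌊n/2⌋` iterations of the procedure always suffice". Proof in
the source: validity of the blossom inequalities `x(E(S)) ≤ l x₀` (`|S| = 2l+1`) for `Nˡ₊(P(G))`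
by Lemma 1.5 of Lovász–Schrijver 1991 and induction on `l`, then Edmonds' matching polytope
theorem (Edmonds 1965). PROVED in the tree: the `N₊`-validity of the blossom inequalities is
`iterate_Nplus_half_subset_blossomCone` (LovaszSchrijverBlossomRank.lean), Edmonds' matching
polytope theorem is `blossomCone_subset_matchingCone` (EdmondsMatchingPolytope.lean, on top of the
perfect matching polytope theorem `PerfectMatchingPolytope.IsOddCutPoint.isPMConv`), and the
discharge is `StephenTuncel1999_rank_le_half_holds : StephenTuncel1999_rank_le_half`
(EdmondsMatchingPolytope.lean); this `def` stays the named statement — feed users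
`(h : StephenTuncel1999_rank_le_half)` with `_holds`.
[cite: StephenTuncel1999, §5, remark after the proof of Thm. 5.1 (p. 7); abstract (p. 1)] -/
def StephenTuncel1999_rank_le_half : Prop :=
  ∀ (m : ℕ) (G : SimpleGraph (Fin m)) [DecidableRel G.Adj],
    Nplus^[m / 2] (fracMatchingCone G) = matchingCone G

/-- The number of edges of `K_{2n+1}` is `(2n+1)·n`. [folklore] -/
private theorem card_edgeSet_clique (n : ℕ) :
    Fintype.card ((⊤ : SimpleGraph (Fin (2 * n + 1))).edgeSet) = (2 * n + 1) * n := by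
  classical
  rw [← SimpleGraph.edgeFinset_card, SimpleGraph.card_edgeFinset_top_eq_card_choose_two,
    Fintype.card_fin, Nat.choose_two_right]
  have : (2 * n + 1) * (2 * n + 1 - 1) = (2 * n + 1) * n * 2 := by
    rw [show 2 * n + 1 - 1 = 2 * n by omega]; ring
  rw [this, Nat.mul_div_cancel _ two_pos]

/-- `ζ ∈ P(2n+1)` (every vertex of `K_{2n+1}` has degree `2n`, so `x(δ(v)) = 1 = x₀`).
[cite: StephenTuncel1999, §4 (p. 4)] -/
theorem zeta_mem_fracMatchingCone (n : ℕ) (hn : 1 ≤ n) :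
    zeta n ∈ fracMatchingCone (⊤ : SimpleGraph (Fin (2 * n + 1))) := by
  classical
  have hn' : (0 : ℝ) < 2 * n := by positivity
  refine ⟨fun i => ?_, fun v => ?_⟩
  · cases i with
    | none => show (0 : ℝ) ≤ 1; exact zero_le_one
    | some e => show (0 : ℝ) ≤ (2 * n : ℝ)⁻¹; exact inv_nonneg.mpr hn'.le
  simp only [zeta, sum_const, nsmul_eq_mul]
  -- the number of edges at `v` is the degree `2n < 2n+1`
  have hcard : (univ.filter (fun e : (⊤ : SimpleGraph (Fin (2 * n + 1))).edgeSet =>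
      v ∈ (e : Sym2 (Fin (2 * n + 1))))).card ≤ 2 * n := by
    have h1 : (univ.filter (fun e : (⊤ : SimpleGraph (Fin (2 * n + 1))).edgeSet =>
        v ∈ (e : Sym2 (Fin (2 * n + 1))))).card =
        ((⊤ : SimpleGraph (Fin (2 * n + 1))).incidenceFinset v).card := by
      rw [SimpleGraph.incidenceFinset_eq_filter, ← Finset.card_map (Function.Embedding.subtype _)]
      congr 1
      ext e
      simp only [Finset.mem_map, Finset.mem_filter, Finset.mem_univ, true_and,
        Function.Embedding.coe_subtype, SimpleGraph.mem_edgeFinset]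
      constructor
      · rintro ⟨e', hv, rfl⟩
        exact ⟨e'.2, hv⟩
      · rintro ⟨he, hv⟩
        exact ⟨⟨e, he⟩, hv, rfl⟩
    rw [h1, SimpleGraph.card_incidenceFinset_eq_degree]
    have := (⊤ : SimpleGraph (Fin (2 * n + 1))).degree_lt_card_verts v
    simp only [Fintype.card_fin] at this
    omega
  calc ((univ.filter (fun e : (⊤ : SimpleGraph (Fin (2 * n + 1))).edgeSet =>
          v ∈ (e : Sym2 (Fin (2 * n + 1))))).card : ℝ) * (2 * n : ℝ)⁻¹
      ≤ (2 * n : ℝ) * (2 * n : ℝ)⁻¹ := by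
        gcongr
        exact_mod_cast hcard
    _ = 1 := mul_inv_cancel₀ hn'.ne'

/-- **`ζ ∉ P_I(2n+1)`**: "Since `Σ_{j ∈ E_{2n+1}} xⱼ = (2n+1)/2 > n`, the maximum cardinality of
any matching in the `(2n+1)` clique, `x ∉ P_I(2n+1)`." [cite: StephenTuncel1999, proof of Thm. 5.1 (p. 6)] -/
theorem zeta_not_mem_matchingCone (n : ℕ) (hn : 1 ≤ n) :
    zeta n ∉ matchingCone (⊤ : SimpleGraph (Fin (2 * n + 1))) := by
  classical
  intro h
  have hle := sum_le_of_mem_matchingCone _ h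
  simp only [zeta, sum_const, card_univ, card_edgeSet_clique, nsmul_eq_mul, mul_one,
    Fintype.card_fin] at hle
  have h2 : (2 * n + 1) / 2 = n := by omega
  rw [h2] at hle
  have hn' : (0 : ℝ) < 2 * n := by positivity
  have : ((2 * n + 1) * n : ℕ) * (2 * n : ℝ)⁻¹ = n + 1 / 2 := by
    field_simp
    push_cast
    ring
  rw [this] at hle
  linarith

/-- **Theorem 5.1** (as printed): "`N^{n-1}₊(P(2n+1)) ≠ P_I(2n+1) = Nⁿ₊(P(2n+1))`", for
`n ≥ 1`, from Lemma 4.2 and the p. 7 upper bound. [cite: StephenTuncel1999, Thm. 5.1 (p. 6)] -/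
theorem StephenTuncel1999_thm51 (h42 : StephenTuncel1999_lemma42)
    (hhalf : StephenTuncel1999_rank_le_half) (n : ℕ) (hn : 1 ≤ n) :
    Nplus^[n - 1] (fracMatchingCone (⊤ : SimpleGraph (Fin (2 * n + 1)))) ≠
        matchingCone (⊤ : SimpleGraph (Fin (2 * n + 1))) ∧
      Nplus^[n] (fracMatchingCone (⊤ : SimpleGraph (Fin (2 * n + 1)))) =
        matchingCone (⊤ : SimpleGraph (Fin (2 * n + 1))) := by
  refine ⟨fun heq => zeta_not_mem_matchingCone n hn (heq ▸ h42 n hn), ?_⟩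
  have h := hhalf (2 * n + 1) ⊤
  rwa [show (2 * n + 1) / 2 = n by omega] at h

/-- From Lemma 4.2 alone: **`Nʳ₊(P(2n+1)) ≠ P_I(2n+1)` for every `r < n`** ("at least `n`
iterations of the procedure are needed", p. 1). [cite: StephenTuncel1999, Thm. 5.1 (p. 6) and §1 (p. 1)] -/
theorem iterate_Nplus_ne_of_lt (h42 : StephenTuncel1999_lemma42) (n : ℕ) (hn : 1 ≤ n)
    (r : ℕ) (hr : r < n) :
    Nplus^[r] (fracMatchingCone (⊤ : SimpleGraph (Fin (2 * n + 1)))) ≠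
      matchingCone (⊤ : SimpleGraph (Fin (2 * n + 1))) := by
  intro heq
  have hmem : zeta n ∈ Nplus^[r] (fracMatchingCone (⊤ : SimpleGraph (Fin (2 * n + 1)))) :=
    iterate_Nplus_antitone _ (show r ≤ n - 1 by omega) (h42 n hn)
  exact zeta_not_mem_matchingCone n hn (heq ▸ hmem)

/-- **The `N₊`-rank of `P(2n+1)` is exactly `n`**: `n` is the least `r` with
`Nʳ₊(P(2n+1)) = P_I(2n+1)` ("the number of iterations … is roughly `√d/2`", `d = n(2n+1)`, p. 1).
[cite: StephenTuncel1999, Thm. 5.1 (p. 6) and §1 (p. 1)] -/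
theorem StephenTuncel1999_rank (h42 : StephenTuncel1999_lemma42)
    (hhalf : StephenTuncel1999_rank_le_half) (n : ℕ) (hn : 1 ≤ n) :
    IsLeast {r : ℕ | Nplus^[r] (fracMatchingCone (⊤ : SimpleGraph (Fin (2 * n + 1)))) =
      matchingCone (⊤ : SimpleGraph (Fin (2 * n + 1)))} n := by
  refine ⟨(StephenTuncel1999_thm51 h42 hhalf n hn).2, fun r hr => ?_⟩
  by_contra hlt
  exact iterate_Nplus_ne_of_lt h42 n hn r (by omega) hr

end StephenTuncel1999

end Literature.Combinatorics.Optimization
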